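import Summits.CriticalPhenomena.CardyFormulaZ2.Theorems.CardySusyWardDiscretisationFamilyExistsAssemblyA
import HarnessLib

/-!
# Patching two labellings of the discrete boundary into a third: helper for stub
`stub_discreteSplitting` of line `hitting-tournament` for crux `LagHandOff` (stmt-CriticalPhenomena-10268)

One mesh, pure lattice combinatorics and metric bookkeeping.  Let `(D; x₀, x₁, x₂)` be a `3`-marked
Jordan domain with arcs `α₀ = [x₀, x₁]`, `α₁ = [x₁, x₂]`, `α₂ = [x₂, x₀]`, and let two labellings of
the square-lattice boundary `∂Ω_δ` of the canonical discrete domain be given (as produced by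
`eventually_labelling` for the chords `(x₀, x₂)` and `(x₁, x₂)`): `SA ⊔ SB` with `SA` within `ε` of
`α₀ ∪ α₁`, `SB` within `ε` of `α₂`, cut edges `e_a` (near `x₀`) and `e_b` (near `x₂`); and
`SA' ⊔ SB'` with `SA'` within `ε` of `α₁`, `SB'` within `ε` of `α₂ ∪ α₀`, cut edges `e₁` (near `x₁`)
and `e_b'` (near `x₂`); both with the no-forcing property.  Then (`splitting_patch`) the labelling
`S₀ ⊔ T` with `S₀ = SA ∩ SB' ∖ (λ-neighbourhood of x₂)`, `T = ∂Ω_δ ∖ S₀` is a labelling for the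
chord `(x₀, x₁)` with the no-forcing property, `S₀` within `ε` of `α₀`, `T` within `ε` of
`α₁ ∪ α₂`, and EXACTLY the two cut edges `e_a`, `e₁`; moreover `S₀ ⊆ SA` and every site of
`SA ∖ S₀` is within `ε` of `α₁` — the input of the one-mesh target-independence lemma.  The metric
side conditions (`g1`–`g8`) hold for all small `ε, δ` by the geometry file.
-/

noncomputable section

open Set Metric
open Literature.Probability.LatticeModels Literature.Probability.Percolation
  Literature.Probability.RandomPlanarGeometry
open Summit.CriticalPhenomena.CardyFormulaZ2.Theorems.DiscretisationFamilyExists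

namespace Summit.CriticalPhenomena.CardyFormulaZ2.Cruxes.LagHandOff.HittingTournament

/-! ### Lattice metric preliminaries -/

/-- Boundary sites are within `2δ` of the frontier. -/
theorem infDist_frontier_le_two_mul (D : JordanDomain) {δ : ℝ} (hδ : 0 < δ) {x : Site 2}
    (hx : x ∈ (⟨D.carrier, δ, ∅, ∅⟩ : DiscreteDobrushin).zdBoundary) :
    infDist (meshPoint δ x) (frontier D.carrier) ≤ 2 * δ := by
  have h := infDist_frontier_le_sqrt_two (E := ⟨D.carrier, δ, ∅, ∅⟩) D.isOpen hδ hx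
  have hs : Real.sqrt 2 < 2 := by rw [Real.sqrt_lt' (by norm_num)]; norm_num
  exact h.trans (by nlinarith)

/-- Two boundary discs with a common point have centres within `4δ`. -/
theorem dist_le_four_mul_of_mem_closedBall (D : JordanDomain) {δ : ℝ} (hδ : 0 < δ) {x y : Site 2} {q : ℂ}
    (hx : x ∈ (⟨D.carrier, δ, ∅, ∅⟩ : DiscreteDobrushin).zdBoundary)
    (hy : y ∈ (⟨D.carrier, δ, ∅, ∅⟩ : DiscreteDobrushin).zdBoundary)
    (hqy : q ∈ closedBall (meshPoint δ y) (infDist (meshPoint δ y) (frontier D.carrier)))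
    (hqx : q ∈ closedBall (meshPoint δ x) (infDist (meshPoint δ x) (frontier D.carrier))) :
    dist (meshPoint δ y) (meshPoint δ x) ≤ 4 * δ := by
  rw [mem_closedBall] at hqy hqx
  have h1 := infDist_frontier_le_two_mul D hδ hx
  have h2 := infDist_frontier_le_two_mul D hδ hy
  rw [dist_comm] at hqy
  linarith [dist_triangle (meshPoint δ y) q (meshPoint δ x)]

/-- Adjacent sites of `Ω_δ` are one mesh apart. -/
theorem dist_eq_of_adj {Ω : Set ℂ} {δ : ℝ} (hδ : 0 ≤ δ) {a b : Site 2}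
    (h : (discreteDomainGraph Ω δ).Adj a b) : dist (meshPoint δ a) (meshPoint δ b) = δ := by
  obtain ⟨k, rfl⟩ := exists_eq_add_cornerUnit (meshGraph_le_zdGraph _ _ (discreteDomainGraph_le_meshGraph _ _ h))
  rw [dist_comm, dist_eq_norm, meshPoint_add, add_sub_cancel_left, norm_meshPoint_cornerUnit, abs_of_nonneg hδ]

/-- An endpoint of an edge of `Ω_δ` is within half a mesh of its midpoint. -/
theorem dist_medialPoint_le_of_mem {Ω : Set ℂ} {δ : ℝ} (hδ : 0 ≤ δ) {e : Sym2 (Site 2)}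
    (he : e ∈ (discreteDomainGraph Ω δ).edgeSet) {p : Site 2} (hp : p ∈ e) :
    dist (meshPoint δ p) (medialPoint δ e) ≤ δ / 2 := by
  induction e using Sym2.ind with
  | h a b =>
    have hab := (SimpleGraph.mem_edgeSet _).1 he
    have key : ∀ {u v : Site 2}, (discreteDomainGraph Ω δ).Adj u v →
        dist (meshPoint δ u) (medialPoint δ s(u, v)) ≤ δ / 2 := by
      intro u v huv
      obtain ⟨k, rfl⟩ := exists_eq_add_cornerUnit
        (meshGraph_le_zdGraph _ _ (discreteDomainGraph_le_meshGraph _ _ huv))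
      rw [medialPoint_mk, dist_eq_norm, meshPoint_add,
        show meshPoint δ u - (meshPoint δ u + (meshPoint δ u + meshPoint δ (cornerUnit k))) / 2 =
          -(meshPoint δ (cornerUnit k) / 2) by ring, norm_neg, norm_div, norm_meshPoint_cornerUnit,
        abs_of_nonneg hδ, Complex.norm_two]
    rcases Sym2.mem_iff.1 hp with rfl | rfl
    · exact key hab
    · rw [Sym2.eq_swap]; exact key hab.symm

/-! ### The patch -/

set_option maxHeartbeats 1600000 in
/-- **Patching two labellings.** See the module docstring. -/
theorem splitting_patch (D : MarkedDomain 3) {δ ε lam : ℝ} (hδ : 0 < δ)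
    {SA SB SA' SB' S0 T : Set (Site 2)} {ea eb e1 eb' : Sym2 (Site 2)}
    (hU : SA ∪ SB = (⟨D.carrier, δ, ∅, ∅⟩ : DiscreteDobrushin).zdBoundary) (hdj : Disjoint SA SB)
    (hNFA : ∀ y ∈ SA, ¬ closedBall (meshPoint δ y) (infDist (meshPoint δ y) (frontier D.carrier)) ⊆
      ⋃ x ∈ SB, closedBall (meshPoint δ x) (infDist (meshPoint δ x) (frontier D.carrier)))
    (hNFB : ∀ x ∈ SB, ¬ closedBall (meshPoint δ x) (infDist (meshPoint δ x) (frontier D.carrier)) ⊆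
      ⋃ y ∈ SA, closedBall (meshPoint δ y) (infDist (meshPoint δ y) (frontier D.carrier)))
    (hsA : ∀ y ∈ SA, infDist (meshPoint δ y) (D.arc 0) ≤ ε ∨ infDist (meshPoint δ y) (D.arc 1) ≤ ε)
    (hsB : ∀ x ∈ SB, infDist (meshPoint δ x) (D.arc 2) ≤ ε)
    (hAB : {e | e ∈ (discreteDomainGraph D.carrier δ).edgeSet ∧ (∃ x ∈ e, x ∈ SA) ∧ ∃ y ∈ e, y ∈ SB} =
      {ea, eb})
    (hea : dist (medialPoint δ ea) (D.pt 0) ≤ ε) (heb : dist (medialPoint δ eb) (D.pt 2) ≤ ε)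
    (hU' : SA' ∪ SB' = (⟨D.carrier, δ, ∅, ∅⟩ : DiscreteDobrushin).zdBoundary) (hdj' : Disjoint SA' SB')
    (hNFA' : ∀ y ∈ SA', ¬ closedBall (meshPoint δ y) (infDist (meshPoint δ y) (frontier D.carrier)) ⊆
      ⋃ x ∈ SB', closedBall (meshPoint δ x) (infDist (meshPoint δ x) (frontier D.carrier)))
    (hNFB' : ∀ x ∈ SB', ¬ closedBall (meshPoint δ x) (infDist (meshPoint δ x) (frontier D.carrier)) ⊆
      ⋃ y ∈ SA', closedBall (meshPoint δ y) (infDist (meshPoint δ y) (frontier D.carrier)))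
    (hsA' : ∀ y ∈ SA', infDist (meshPoint δ y) (D.arc 1) ≤ ε)
    (hsB' : ∀ x ∈ SB', infDist (meshPoint δ x) (D.arc 2) ≤ ε ∨ infDist (meshPoint δ x) (D.arc 0) ≤ ε)
    (hAB' : {e | e ∈ (discreteDomainGraph D.carrier δ).edgeSet ∧ (∃ x ∈ e, x ∈ SA') ∧ ∃ y ∈ e, y ∈ SB'} =
      {e1, eb'})
    (he1 : dist (medialPoint δ e1) (D.pt 1) ≤ ε) (heb' : dist (medialPoint δ eb') (D.pt 2) ≤ ε)
    (g1 : ∀ z : ℂ, infDist z (D.arc 1) ≤ ε → infDist z (D.arc 2) ≤ ε → dist z (D.pt 2) < lam)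
    (g2 : ∀ z : ℂ, infDist z (D.arc 0) ≤ ε → infDist z (D.arc 1) ≤ ε + 4 * δ →
      infDist z (D.arc 2) ≤ ε + 4 * δ → False)
    (g3 : lam + ε + 4 * δ < infDist (D.pt 2) (D.arc 0))
    (g4 : 2 * ε + δ < infDist (D.pt 0) (D.arc 1)) (g5 : 2 * ε + δ < infDist (D.pt 1) (D.arc 2))
    (g6 : lam + ε + δ ≤ dist (D.pt 0) (D.pt 2)) (g7 : lam + ε + δ ≤ dist (D.pt 1) (D.pt 2))
    (g8 : ε + δ < lam)
    (hS0 : S0 = {y | y ∈ SA ∧ y ∈ SB' ∧ lam ≤ dist (meshPoint δ y) (D.pt 2)})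
    (hT : T = (⟨D.carrier, δ, ∅, ∅⟩ : DiscreteDobrushin).zdBoundary \ S0) :
    (S0 ∪ T = (⟨D.carrier, δ, ∅, ∅⟩ : DiscreteDobrushin).zdBoundary ∧
      Disjoint S0 T ∧ S0.Nonempty ∧ T.Nonempty ∧
      (∀ y ∈ S0, ¬ closedBall (meshPoint δ y) (infDist (meshPoint δ y) (frontier D.carrier)) ⊆
        ⋃ x ∈ T, closedBall (meshPoint δ x) (infDist (meshPoint δ x) (frontier D.carrier))) ∧
      (∀ x ∈ T, ¬ closedBall (meshPoint δ x) (infDist (meshPoint δ x) (frontier D.carrier)) ⊆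
        ⋃ y ∈ S0, closedBall (meshPoint δ y) (infDist (meshPoint δ y) (frontier D.carrier))) ∧
      (∀ y ∈ S0, infDist (meshPoint δ y) (D.arc 0) ≤ ε) ∧
      (∀ x ∈ T, infDist (meshPoint δ x) (D.arc 1) ≤ ε ∨ infDist (meshPoint δ x) (D.arc 2) ≤ ε) ∧
      {e | e ∈ (discreteDomainGraph D.carrier δ).edgeSet ∧ (∃ x ∈ e, x ∈ S0) ∧ ∃ y ∈ e, y ∈ T} =
        {ea, e1} ∧ ea ≠ e1) ∧
      S0 ⊆ SA ∧ SB ⊆ T ∧ ∀ y ∈ SA, y ∉ S0 → infDist (meshPoint δ y) (D.arc 1) ≤ ε := by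
  set bd := (⟨D.carrier, δ, ∅, ∅⟩ : DiscreteDobrushin).zdBoundary with hbd
  have hδ0 : 0 ≤ δ := hδ.le
  -- marked points on the arcs
  have hx1α1 : D.pt 1 ∈ D.arc 1 := D.pt_mem_arc_self 1
  have hx2α2 : D.pt 2 ∈ D.arc 2 := D.pt_mem_arc_self 2
  have hx0α2 : D.pt 0 ∈ D.arc 2 := by simpa using D.pt_succ_mem_arc 2
  -- membership bookkeeping
  have hSA : SA ⊆ bd := hU ▸ subset_union_left
  have hSB : SB ⊆ bd := hU ▸ subset_union_right
  have hSA' : SA' ⊆ bd := hU' ▸ subset_union_left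
  have hSB' : SB' ⊆ bd := hU' ▸ subset_union_right
  have hbdU : ∀ x ∈ bd, x ∈ SA ∨ x ∈ SB := fun x hx => by rw [← hU] at hx; exact hx
  have hbdU' : ∀ x ∈ bd, x ∈ SA' ∨ x ∈ SB' := fun x hx => by rw [← hU'] at hx; exact hx
  have hS0A : S0 ⊆ SA := fun y hy => by rw [hS0] at hy; exact hy.1
  have hS0B' : S0 ⊆ SB' := fun y hy => by rw [hS0] at hy; exact hy.2.1
  have hS0far : ∀ y ∈ S0, lam ≤ dist (meshPoint δ y) (D.pt 2) := fun y hy => by rw [hS0] at hy; exact hy.2.2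
  have hS0bd : S0 ⊆ bd := hS0A.trans hSA
  have hTbd : T ⊆ bd := fun x hx => by rw [hT] at hx; exact hx.1
  have hTiff : ∀ x, x ∈ T ↔ x ∈ bd ∧ x ∉ S0 := fun x => by rw [hT]; rfl
  have hSBT : SB ⊆ T := fun x hx => (hTiff x).2 ⟨hSB hx, fun h => Set.disjoint_left.1 hdj (hS0A h) hx⟩
  -- metric consequences of the two side properties
  -- (i) a site of `SA ∩ SB'` is `ε`-close to `α₀` or `λ`-close to `x₂`
  have hAB'_alt : ∀ y ∈ SA, y ∈ SB' →
      infDist (meshPoint δ y) (D.arc 0) ≤ ε ∨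
        (infDist (meshPoint δ y) (D.arc 1) ≤ ε ∧ infDist (meshPoint δ y) (D.arc 2) ≤ ε) := by
    intro y hyA hyB'
    rcases hsA y hyA with h0 | h1
    · exact Or.inl h0
    rcases hsB' y hyB' with h2 | h0
    · exact Or.inr ⟨h1, h2⟩
    · exact Or.inl h0
  -- (ii) sites `ε`-close to `α₀` are far from `x₂`
  have hfar_of_α0 : ∀ z : ℂ, infDist z (D.arc 0) ≤ ε → lam + 4 * δ < dist z (D.pt 2) := by
    intro z hz
    have := infDist_le_infDist_add_dist (s := D.arc 0) (x := D.pt 2) (y := z)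
    rw [dist_comm] at this
    linarith
  -- (iii) sides of `S0` and of `SA ∖ S0`
  have hS0α0 : ∀ y ∈ S0, infDist (meshPoint δ y) (D.arc 0) ≤ ε := by
    intro y hy
    rcases hAB'_alt y (hS0A hy) (hS0B' hy) with h | ⟨h1, h2⟩
    · exact h
    · exact absurd (g1 _ h1 h2) (not_lt.2 (hS0far y hy))
  have hS0far' : ∀ y ∈ S0, lam + 4 * δ < dist (meshPoint δ y) (D.pt 2) := fun y hy =>
    hfar_of_α0 _ (hS0α0 y hy)
  have hrest : ∀ y ∈ SA, y ∉ S0 → infDist (meshPoint δ y) (D.arc 1) ≤ ε ∧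
      (y ∈ SB' → dist (meshPoint δ y) (D.pt 2) < lam) := by
    intro y hyA hyS
    rcases hbdU' y (hSA hyA) with hyA' | hyB'
    · exact ⟨hsA' y hyA', fun h => absurd hyA' (fun h' => Set.disjoint_left.1 hdj' h' h)⟩
    have hnear : dist (meshPoint δ y) (D.pt 2) < lam := by
      by_contra hle
      exact hyS (by rw [hS0]; exact ⟨hyA, hyB', not_lt.1 hle⟩)
    rcases hAB'_alt y hyA hyB' with h | ⟨h1, -⟩
    · linarith [hfar_of_α0 _ h, hδ]
    · exact ⟨h1, fun _ => hnear⟩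
  -- (iv) no edge and no common disc point between `S0` and the near part of `SA ∩ SB'`
  have hgap : ∀ y ∈ S0, ∀ x ∈ SA, x ∉ S0 → x ∈ SB' → 4 * δ < dist (meshPoint δ y) (meshPoint δ x) := by
    intro y hy x hxA hxS hxB'
    have h1 := hS0far' y hy
    have h2 := (hrest x hxA hxS).2 hxB'
    linarith [dist_triangle (meshPoint δ y) (meshPoint δ x) (D.pt 2)]
  -- the cut edge `e_a`: ends `pa ∈ S0`, `qa ∈ SB`
  have hea_mem : ea ∈ {e | e ∈ (discreteDomainGraph D.carrier δ).edgeSet ∧ (∃ x ∈ e, x ∈ SA) ∧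
      ∃ y ∈ e, y ∈ SB} := by rw [hAB]; exact Or.inl rfl
  obtain ⟨hea_e, ⟨pa, hpa, hpaA⟩, ⟨qa, hqa, hqaB⟩⟩ := hea_mem
  have hpa_x0 : dist (meshPoint δ pa) (D.pt 0) ≤ ε + δ / 2 := by
    linarith [dist_triangle (meshPoint δ pa) (medialPoint δ ea) (D.pt 0), dist_medialPoint_le_of_mem hδ0 hea_e hpa]
  have hpaS0 : pa ∈ S0 := by
    rw [hS0]
    refine ⟨hpaA, ?_, ?_⟩
    · rcases hbdU' pa (hSA hpaA) with h | h
      · exfalso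
        have h1 := hsA' pa h
        have := infDist_le_infDist_add_dist (s := D.arc 1) (x := D.pt 0) (y := meshPoint δ pa)
        rw [dist_comm] at this
        linarith
      · exact h
    · linarith [dist_triangle (D.pt 0) (meshPoint δ pa) (D.pt 2), dist_comm (D.pt 0) (meshPoint δ pa)]
  have hqaT : qa ∈ T := hSBT hqaB
  -- the cut edge `e₁`: ends `p1 ∈ S0` (`SB'`-end), `q1 ∈ SA ∩ SA'`
  have he1_mem : e1 ∈ {e | e ∈ (discreteDomainGraph D.carrier δ).edgeSet ∧ (∃ x ∈ e, x ∈ SA') ∧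
      ∃ y ∈ e, y ∈ SB'} := by rw [hAB']; exact Or.inl rfl
  obtain ⟨he1_e, ⟨q1, hq1, hq1A'⟩, ⟨p1, hp1, hp1B'⟩⟩ := he1_mem
  have hend_x1 : ∀ p ∈ e1, dist (meshPoint δ p) (D.pt 1) ≤ ε + δ / 2 := fun p hp => by
    linarith [dist_triangle (meshPoint δ p) (medialPoint δ e1) (D.pt 1), dist_medialPoint_le_of_mem hδ0 he1_e hp]
  have hend_A : ∀ p ∈ e1, p ∈ bd → p ∈ SA := by
    intro p hp hpbd
    rcases hbdU p hpbd with h | h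
    · exact h
    · exfalso
      have h1 := hsB p h
      have := infDist_le_infDist_add_dist (s := D.arc 2) (x := D.pt 1) (y := meshPoint δ p)
      rw [dist_comm] at this
      linarith [hend_x1 p hp]
  have hp1S0 : p1 ∈ S0 := by
    rw [hS0]
    refine ⟨hend_A p1 hp1 (hSB' hp1B'), hp1B', ?_⟩
    linarith [dist_triangle (D.pt 1) (meshPoint δ p1) (D.pt 2), dist_comm (D.pt 1) (meshPoint δ p1),
      hend_x1 p1 hp1]
  have hq1T : q1 ∈ T :=
    (hTiff q1).2 ⟨hSA' hq1A', fun h => Set.disjoint_left.1 hdj' hq1A' (hS0B' h)⟩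
  have hne : ea ≠ e1 := by
    intro h
    have h0 : dist (medialPoint δ ea) (D.pt 0) ≤ ε := hea
    have h1 : dist (medialPoint δ ea) (D.pt 1) ≤ ε := h ▸ he1
    have : infDist (D.pt 0) (D.arc 1) ≤ dist (D.pt 0) (D.pt 1) := infDist_le_dist_of_mem hx1α1
    linarith [dist_triangle (D.pt 0) (medialPoint δ ea) (D.pt 1), dist_comm (D.pt 0) (medialPoint δ ea)]
  -- ends of the cut edges near `x₂` are not in `S0`
  have hnotS0_of_near : ∀ {e : Sym2 (Site 2)}, e ∈ (discreteDomainGraph D.carrier δ).edgeSet →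
      dist (medialPoint δ e) (D.pt 2) ≤ ε → ∀ p ∈ e, p ∉ S0 := by
    intro e he hex p hp hpS
    have := hS0far p hpS
    linarith [dist_triangle (meshPoint δ p) (medialPoint δ e) (D.pt 2), dist_medialPoint_le_of_mem hδ0 he hp]
  -- the two-coloured edges of the patched labelling
  have hcut : {e | e ∈ (discreteDomainGraph D.carrier δ).edgeSet ∧ (∃ x ∈ e, x ∈ S0) ∧ ∃ y ∈ e, y ∈ T} =
      {ea, e1} := by
    refine Subset.antisymm ?_ ?_
    · rintro e ⟨he, ⟨p, hp, hpS⟩, ⟨q, hq, hqT⟩⟩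
      obtain ⟨hqbd, hqS⟩ := (hTiff q).1 hqT
      have hpq : p ≠ q := fun h => hqS (h ▸ hpS)
      have he_eq : e = s(p, q) := (Sym2.mem_and_mem_iff hpq).1 ⟨hp, hq⟩
      rcases hbdU q hqbd with hqA | hqB
      · -- `q ∈ SA ∖ S0`
        rcases hbdU' q hqbd with hqA' | hqB'
        · -- an `SA'`–`SB'` edge: `e₁` (or `e_b'`, excluded)
          have hmem : e ∈ ({e1, eb'} : Set (Sym2 (Site 2))) := by
            rw [← hAB']; exact ⟨he, ⟨q, hq, hqA'⟩, ⟨p, hp, hS0B' hpS⟩⟩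
          rcases hmem with h | h
          · exact Or.inr h
          · exact absurd hpS (hnotS0_of_near (h ▸ he) (h ▸ heb') p hp)
        · -- both ends in `SA ∩ SB'`, one far and one near: too long
          exfalso
          have h1 := hgap p hpS q hqA hqS hqB'
          have h2 := dist_eq_of_adj hδ0 ((SimpleGraph.mem_edgeSet _).1 (he_eq ▸ he))
          linarith
      · -- an `SA`–`SB` edge: `e_a` (or `e_b`, excluded)
        have hmem : e ∈ ({ea, eb} : Set (Sym2 (Site 2))) := by
          rw [← hAB]; exact ⟨he, ⟨p, hp, hS0A hpS⟩, ⟨q, hq, hqB⟩⟩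
        rcases hmem with h | h
        · exact Or.inl h
        · exact absurd hpS (hnotS0_of_near (h ▸ he) (h ▸ heb) p hp)
    · rintro e (rfl | rfl)
      · exact ⟨hea_e, ⟨pa, hpa, hpaS0⟩, ⟨qa, hqa, hqaT⟩⟩
      · exact ⟨he1_e, ⟨p1, hp1, hp1S0⟩, ⟨q1, hq1, hq1T⟩⟩
  refine ⟨⟨?_, ?_, ⟨pa, hpaS0⟩, ⟨qa, hqaT⟩, ?_, ?_, hS0α0, ?_, hcut, hne⟩, hS0A, hSBT,
    fun y hy hyS => (hrest y hy hyS).1⟩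
  · -- union
    refine Subset.antisymm (union_subset hS0bd hTbd) fun x hx => ?_
    by_cases h : x ∈ S0
    · exact Or.inl h
    · exact Or.inr ((hTiff x).2 ⟨hx, h⟩)
  · exact Set.disjoint_left.2 fun x hxS hxT => ((hTiff x).1 hxT).2 hxS
  · -- no forcing of `S0` by `T`
    intro y hy hcov
    obtain ⟨q, hqy, hq⟩ := not_subset.1 (hNFA y (hS0A hy))
    obtain ⟨q', hq'y, hq'⟩ := not_subset.1 (hNFB' y (hS0B' hy))
    -- `q` lies in the disc of a site of `T ∖ SB ⊆ SA ∖ S0`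
    obtain ⟨x, hxT, hqx⟩ : ∃ x ∈ T, q ∈ closedBall (meshPoint δ x)
        (infDist (meshPoint δ x) (frontier D.carrier)) := by simpa only [mem_iUnion, exists_prop] using hcov hqy
    obtain ⟨hxbd, hxS⟩ := (hTiff x).1 hxT
    have hxB : x ∉ SB := fun h => hq (mem_iUnion₂.2 ⟨x, h, hqx⟩)
    have hxA : x ∈ SA := (hbdU x hxbd).resolve_right hxB
    have hdx := dist_le_four_mul_of_mem_closedBall D.toJordanDomain hδ hxbd (hS0bd hy) hqy hqx
    have hxA' : x ∉ SB' := fun h => by linarith [hgap y hy x hxA hxS h]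
    have hα1 : infDist (meshPoint δ y) (D.arc 1) ≤ ε + 4 * δ := by
      have := infDist_le_infDist_add_dist (s := D.arc 1) (x := meshPoint δ y) (y := meshPoint δ x)
      linarith [(hrest x hxA hxS).1]
    -- `q'` lies in the disc of a site of `T ∖ SA' = T ∩ SB'`
    obtain ⟨x', hx'T, hqx'⟩ : ∃ x ∈ T, q' ∈ closedBall (meshPoint δ x)
        (infDist (meshPoint δ x) (frontier D.carrier)) := by simpa only [mem_iUnion, exists_prop] using hcov hq'y
    obtain ⟨hx'bd, hx'S⟩ := (hTiff x').1 hx'T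
    have hx'A' : x' ∉ SA' := fun h => hq' (mem_iUnion₂.2 ⟨x', h, hqx'⟩)
    have hx'B' : x' ∈ SB' := (hbdU' x' hx'bd).resolve_left hx'A'
    have hdx' := dist_le_four_mul_of_mem_closedBall D.toJordanDomain hδ hx'bd (hS0bd hy) hq'y hqx'
    rcases hbdU x' hx'bd with hx'A | hx'B
    · linarith [hgap y hy x' hx'A hx'S hx'B']
    · have hα2 : infDist (meshPoint δ y) (D.arc 2) ≤ ε + 4 * δ := by
        have := infDist_le_infDist_add_dist (s := D.arc 2) (x := meshPoint δ y) (y := meshPoint δ x')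
        linarith [hsB x' hx'B]
      exact g2 _ (hS0α0 y hy) hα1 hα2
  · -- no forcing of `T` by `S0`
    intro x hxT hcov
    obtain ⟨hxbd, hxS⟩ := (hTiff x).1 hxT
    have hmono : (⋃ y ∈ S0, closedBall (meshPoint δ y) (infDist (meshPoint δ y) (frontier D.carrier))) ⊆
        ⋃ y ∈ SA, closedBall (meshPoint δ y) (infDist (meshPoint δ y) (frontier D.carrier)) :=
      biUnion_subset_biUnion_left hS0A
    have hmono' : (⋃ y ∈ S0, closedBall (meshPoint δ y) (infDist (meshPoint δ y) (frontier D.carrier))) ⊆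
        ⋃ y ∈ SB', closedBall (meshPoint δ y) (infDist (meshPoint δ y) (frontier D.carrier)) :=
      biUnion_subset_biUnion_left hS0B'
    rcases hbdU x hxbd with hxA | hxB
    · rcases hbdU' x hxbd with hxA' | hxB'
      · exact hNFA' x hxA' (hcov.trans hmono')
      · -- the centre of the disc of `x` lies in the disc of a far site of `S0`
        have hc : meshPoint δ x ∈ closedBall (meshPoint δ x) (infDist (meshPoint δ x) (frontier D.carrier)) :=
          mem_closedBall_self infDist_nonneg
        obtain ⟨y, hyS, hxy⟩ : ∃ y ∈ S0, meshPoint δ x ∈ closedBall (meshPoint δ y)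
            (infDist (meshPoint δ y) (frontier D.carrier)) := by
          simpa only [mem_iUnion, exists_prop] using hcov hc
        have := dist_le_four_mul_of_mem_closedBall D.toJordanDomain hδ hxbd (hS0bd hyS) hxy hc
        linarith [hgap y hyS x hxA hxS hxB']
    · exact hNFB x hxB (hcov.trans hmono)
  · -- sides of `T`
    intro x hxT
    obtain ⟨hxbd, hxS⟩ := (hTiff x).1 hxT
    rcases hbdU x hxbd with hxA | hxB
    · exact Or.inl (hrest x hxA hxS).1
    · exact Or.inr (hsB x hxB)

/-! ### Registered sub-goal (one-line signature, verbatim) -/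

/-- **Registered sub-goal `stub_discreteSplitting_patch` of `stub_discreteSplitting`**: the one-mesh
patching of two labellings `splitting_patch`, fully quantified. -/
theorem stub_discreteSplitting_patch : ∀ (D : MarkedDomain 3) (δ ε lam : ℝ), 0 < δ → ∀ (SA SB SA' SB' S0 T : Set (Site 2)) (ea eb e1 eb' : Sym2 (Site 2)), (SA ∪ SB = (⟨D.carrier, δ, ∅, ∅⟩ : DiscreteDobrushin).zdBoundary) → Disjoint SA SB → (∀ y ∈ SA, ¬ Metric.closedBall (meshPoint δ y) (Metric.infDist (meshPoint δ y) (frontier D.carrier)) ⊆ ⋃ x ∈ SB, Metric.closedBall (meshPoint δ x) (Metric.infDist (meshPoint δ x) (frontier D.carrier))) → (∀ x ∈ SB, ¬ Metric.closedBall (meshPoint δ x) (Metric.infDist (meshPoint δ x) (frontier D.carrier)) ⊆ ⋃ y ∈ SA, Metric.closedBall (meshPoint δ y) (Metric.infDist (meshPoint δ y) (frontier D.carrier))) → (∀ y ∈ SA, Metric.infDist (meshPoint δ y) (D.arc 0) ≤ ε ∨ Metric.infDist (meshPoint δ y) (D.arc 1) ≤ ε) → (∀ x ∈ SB, Metric.infDist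 (meshPoint δ x) (D.arc 2) ≤ ε) → {e | e ∈ (discreteDomainGraph D.carrier δ).edgeSet ∧ (∃ x ∈ e, x ∈ SA) ∧ ∃ y ∈ e, y ∈ SB} = {ea, eb} → dist (medialPoint δ ea) (D.pt 0) ≤ ε → dist (medialPoint δ eb) (D.pt 2) ≤ ε → (SA' ∪ SB' = (⟨D.carrier, δ, ∅, ∅⟩ : DiscreteDobrushin).zdBoundary) → Disjoint SA' SB' → (∀ y ∈ SA', ¬ Metric.closedBall (meshPoint δ y) (Metric.infDist (meshPoint δ y) (frontier D.carrier)) ⊆ ⋃ x ∈ SB', Metric.closedBall (meshPoint δ x) (Metric.infDist (meshPoint δ x) (frontier D.carrier))) → (∀ x ∈ SB', ¬ Metric.closedBall (meshPoint δ x) (Metric.infDist (meshPoint δ x) (frontier D.carrier)) ⊆ ⋃ y ∈ SA', Metric.closedBall (meshPoint δ y) (Metric.infDist (meshPoint δ y) (frontier D.carrier))) → (∀ y ∈ SA', Metric.infDist (meshPoint δ y) (D.arc 1) ≤ ε) → (∀ x ∈ SB', Metric.infDist (meshPoint δ x) (D.arc 2) ≤ ε ∨ Metric.infDist (meshPoint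 δ x) (D.arc 0) ≤ ε) → {e | e ∈ (discreteDomainGraph D.carrier δ).edgeSet ∧ (∃ x ∈ e, x ∈ SA') ∧ ∃ y ∈ e, y ∈ SB'} = {e1, eb'} → dist (medialPoint δ e1) (D.pt 1) ≤ ε → dist (medialPoint δ eb') (D.pt 2) ≤ ε → (∀ z : ℂ, Metric.infDist z (D.arc 1) ≤ ε → Metric.infDist z (D.arc 2) ≤ ε → dist z (D.pt 2) < lam) → (∀ z : ℂ, Metric.infDist z (D.arc 0) ≤ ε → Metric.infDist z (D.arc 1) ≤ ε + 4 * δ → Metric.infDist z (D.arc 2) ≤ ε + 4 * δ → False) → lam + ε + 4 * δ < Metric.infDist (D.pt 2) (D.arc 0) → 2 * ε + δ < Metric.infDist (D.pt 0) (D.arc 1) → 2 * ε + δ < Metric.infDist (D.pt 1) (D.arc 2) → lam + ε + δ ≤ dist (D.pt 0) (D.pt 2) → lam + ε + δ ≤ dist (D.pt 1) (D.pt 2) → ε + δ < lam → S0 = {y | y ∈ SA ∧ y ∈ SB' ∧ lam ≤ dist (meshPoint δ y) (D.pt 2)} → T = (⟨D.carrier, δ, ∅, ∅⟩ : DiscreteDobrushin).zdBoundary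 \ S0 → (S0 ∪ T = (⟨D.carrier, δ, ∅, ∅⟩ : DiscreteDobrushin).zdBoundary ∧ Disjoint S0 T ∧ S0.Nonempty ∧ T.Nonempty ∧ (∀ y ∈ S0, ¬ Metric.closedBall (meshPoint δ y) (Metric.infDist (meshPoint δ y) (frontier D.carrier)) ⊆ ⋃ x ∈ T, Metric.closedBall (meshPoint δ x) (Metric.infDist (meshPoint δ x) (frontier D.carrier))) ∧ (∀ x ∈ T, ¬ Metric.closedBall (meshPoint δ x) (Metric.infDist (meshPoint δ x) (frontier D.carrier)) ⊆ ⋃ y ∈ S0, Metric.closedBall (meshPoint δ y) (Metric.infDist (meshPoint δ y) (frontier D.carrier))) ∧ (∀ y ∈ S0, Metric.infDist (meshPoint δ y) (D.arc 0) ≤ ε) ∧ (∀ x ∈ T, Metric.infDist (meshPoint δ x) (D.arc 1) ≤ ε ∨ Metric.infDist (meshPoint δ x) (D.arc 2) ≤ ε) ∧ {e | e ∈ (discreteDomainGraph D.carrier δ).edgeSet ∧ (∃ x ∈ e, x ∈ S0) ∧ ∃ y ∈ e, y ∈ T} = {ea, e1} ∧ ea ≠ e1) ∧ S0 ⊆ SA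 ∧ SB ⊆ T ∧ ∀ y ∈ SA, y ∉ S0 → Metric.infDist (meshPoint δ y) (D.arc 1) ≤ ε :=
  fun D _ _ _ hδ _ _ _ _ _ _ _ _ _ _ hU hdj hNFA hNFB hsA hsB hAB hea heb hU' hdj' hNFA' hNFB' hsA' hsB' hAB' he1 heb'
      g1 g2 g3 g4 g5 g6 g7 g8 hS0 hT =>
    splitting_patch D hδ hU hdj hNFA hNFB hsA hsB hAB hea heb hU' hdj' hNFA' hNFB' hsA' hsB' hAB' he1 heb'
      g1 g2 g3 g4 g5 g6 g7 g8 hS0 hT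

end Summit.CriticalPhenomena.CardyFormulaZ2.Cruxes.LagHandOff.HittingTournament

end
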